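import Mathlib
import Summits.RiemannHypothesis.RiemannHypothesis.Theorems.WeilParityOffLineParityDetectionTrialIntegrals
import Summits.RiemannHypothesis.RiemannHypothesis.Theorems.RuelleBandExactFirstBandStubOddSectorCriterion
import Literature.NumberTheory.LFunctions.WeilMellinBounds
import HarnessLib

/-!
# Weil transforms of the odd trial function `χ(t) sinh(ηt) cos(γt)`

Route `WeilParity`, crux `OffLineParityDetection` (item stmt-RiemannHypothesis-15431), line
`registered`, stub `stub_dominantQuadrupleOddTrial` (TRIAL).  Helper file (no zeta facts, no
definitions).  For a REAL test function written `o = f` with `f : ℝ → ℝ` and `ρ = 1/2 + η + iγ`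
(`ô = weilMellin o`, `ô(ρ) = ∫ o(t) e^{(ρ - 1/2)t} dt`):

* `trial_weilMellin_re`, `trial_weilMellin_im` — `Re ô(ρ) = ∫ f e^{ηt} cos(γt)`,
  `Im ô(ρ) = ∫ f e^{ηt} sin(γt)`;
* `trial_integral_odd_mul_exp_mul_cos/sin` — for ODD `f` the even halves of `e^{ηt} = cosh + sinh`
  drop out: `∫ f e^{ηt} cos(γt) = ∫ f sinh(ηt) cos(γt)`, `∫ f e^{ηt} sin(γt) = ∫ f cosh(ηt) sin(γt)`;
* `trial_norm_weilMellin_le` — `‖ô(ρ)‖ ≤ e^{|η| a} ∫ |o|` when `tsupport o ⊆ [-a, a]`;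
* `trial_re_sq_weilMellin_conj`, `trial_re_sq_weilMellin_one_sub` — for real odd `o` the number
  `Re ô(ρ)²` is the same at the four points `ρ, ρ̄, 1 - ρ, 1 - ρ̄` (tree:
  `conj_weilMellin_of_real`, `weilMellin_one_sub_of_odd`);
* `trial_threshold_abs`, `trial_threshold_nonneg`, `trial_threshold_le` — the threshold integral
  `∫_{[-a,a]} sinh²(ηt) sin²(γt) dt` depends only on `|η|, |γ|`, is `≥ 0` and `≤ 2a e^{2|η|a}`;
* `trial_norm_sq_le_re`, `trial_inner_le_norm_sq`, `trial_norm_sq_le_window` — for the trial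
  function `f = χ · s`, `s = sinh(η·) cos(γ·)`, `0 ≤ χ ≤ 1` a plateau of the window:
  `∫ f² ≤ ∫ f s`, `∫_{[-b,b]} s² ≤ ∫ f²` (`χ = 1` on `[-b, b]`), `∫ f² ≤ ∫_{[-a,a]} s²`.

Everything is folklore analysis and fully proved.
-/

set_option linter.dupNamespace false

noncomputable section

namespace Summit.RiemannHypothesis.RiemannHypothesis.Theorems.WeilParityOffLineParityDetection

open MeasureTheory Set Real
open scoped ComplexConjugate
open Literature.NumberTheory.LFunctions
open Summit.RiemannHypothesis.RiemannHypothesis.Theorems.RuelleBandExactFirstBand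

/-! ## Real and imaginary parts of the transform of a real function -/

/-- For real `f` (continuous, compact support) and `ρ = 1/2 + η + iγ`:
`Re f̂(ρ) = ∫ f(t) e^{ηt} cos(γt) dt`. [folklore] -/
theorem trial_weilMellin_re {f : ℝ → ℝ} (hf : Continuous f) (hfs : HasCompactSupport f) (ρ : ℂ) :
    (weilMellin (fun t ↦ ((f t : ℝ) : ℂ)) ρ).re =
      ∫ t, f t * (Real.exp ((ρ.re - 1 / 2) * t) * Real.cos (ρ.im * t)) := by
  have hint : Integrable fun t : ℝ ↦ ((f t : ℝ) : ℂ) * Complex.exp ((ρ - 1 / 2) * t) :=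
    integrable_weilIntegrand (g := fun t ↦ ((f t : ℝ) : ℂ)) (Complex.continuous_ofReal.comp hf)
      (hfs.comp_left Complex.ofReal_zero) ρ
  have h1 : (weilMellin (fun t ↦ ((f t : ℝ) : ℂ)) ρ).re =
      ∫ t : ℝ, (((f t : ℝ) : ℂ) * Complex.exp ((ρ - 1 / 2) * t)).re := by
    rw [weilMellin, ← RCLike.re_to_complex, ← integral_re hint]
    rfl
  rw [h1]
  congr 1 with t
  have hre : ((ρ - 1 / 2) * (t : ℂ)).re = (ρ.re - 1 / 2) * t := by simp [Complex.mul_re]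
  have him : ((ρ - 1 / 2) * (t : ℂ)).im = ρ.im * t := by simp [Complex.mul_im]
  rw [Complex.re_ofReal_mul, Complex.exp_re, hre, him]

/-- For real `f` (continuous, compact support) and `ρ = 1/2 + η + iγ`:
`Im f̂(ρ) = ∫ f(t) e^{ηt} sin(γt) dt`. [folklore] -/
theorem trial_weilMellin_im {f : ℝ → ℝ} (hf : Continuous f) (hfs : HasCompactSupport f) (ρ : ℂ) :
    (weilMellin (fun t ↦ ((f t : ℝ) : ℂ)) ρ).im =
      ∫ t, f t * (Real.exp ((ρ.re - 1 / 2) * t) * Real.sin (ρ.im * t)) := by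
  have hint : Integrable fun t : ℝ ↦ ((f t : ℝ) : ℂ) * Complex.exp ((ρ - 1 / 2) * t) :=
    integrable_weilIntegrand (g := fun t ↦ ((f t : ℝ) : ℂ)) (Complex.continuous_ofReal.comp hf)
      (hfs.comp_left Complex.ofReal_zero) ρ
  have h1 : (weilMellin (fun t ↦ ((f t : ℝ) : ℂ)) ρ).im =
      ∫ t : ℝ, (((f t : ℝ) : ℂ) * Complex.exp ((ρ - 1 / 2) * t)).im := by
    rw [weilMellin, ← RCLike.im_to_complex, ← integral_im hint]
    rfl
  rw [h1]
  congr 1 with t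
  have hre : ((ρ - 1 / 2) * (t : ℂ)).re = (ρ.re - 1 / 2) * t := by simp [Complex.mul_re]
  have him : ((ρ - 1 / 2) * (t : ℂ)).im = ρ.im * t := by simp [Complex.mul_im]
  rw [Complex.im_ofReal_mul, Complex.exp_im, hre, him]

/-! ## Odd functions against `e^{ηt} cos(γt)` and `e^{ηt} sin(γt)` -/

/-- For ODD continuous compactly supported `f`:
`∫ f(t) e^{ηt} cos(γt) dt = ∫ f(t) sinh(ηt) cos(γt) dt` (the `cosh` half is odd). [folklore] -/
theorem trial_integral_odd_mul_exp_mul_cos {f : ℝ → ℝ} (hf : Continuous f)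
    (hfs : HasCompactSupport f) (hodd : ∀ t, f (-t) = -f t) (η γ : ℝ) :
    ∫ t, f t * (Real.exp (η * t) * Real.cos (γ * t)) =
      ∫ t, f t * (Real.sinh (η * t) * Real.cos (γ * t)) := by
  have hi1 : Integrable fun t ↦ f t * (Real.cosh (η * t) * Real.cos (γ * t)) :=
    (hf.mul (by fun_prop)).integrable_of_hasCompactSupport hfs.mul_right
  have hi2 : Integrable fun t ↦ f t * (Real.sinh (η * t) * Real.cos (γ * t)) :=
    (hf.mul (by fun_prop)).integrable_of_hasCompactSupport hfs.mul_right
  have hsplit : ∀ t, f t * (Real.exp (η * t) * Real.cos (γ * t)) =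
      f t * (Real.cosh (η * t) * Real.cos (γ * t)) + f t * (Real.sinh (η * t) * Real.cos (γ * t)) := by
    intro t
    rw [← Real.cosh_add_sinh]
    ring
  simp_rw [hsplit]
  rw [integral_add hi1 hi2, trial_integral_odd_eq_zero fun t ↦ ?_, zero_add]
  rw [hodd, mul_neg, mul_neg, Real.cosh_neg, Real.cos_neg, neg_mul]

/-- For ODD continuous compactly supported `f`:
`∫ f(t) e^{ηt} sin(γt) dt = ∫ f(t) cosh(ηt) sin(γt) dt` (the `sinh` half is odd). [folklore] -/
theorem trial_integral_odd_mul_exp_mul_sin {f : ℝ → ℝ} (hf : Continuous f)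
    (hfs : HasCompactSupport f) (hodd : ∀ t, f (-t) = -f t) (η γ : ℝ) :
    ∫ t, f t * (Real.exp (η * t) * Real.sin (γ * t)) =
      ∫ t, f t * (Real.cosh (η * t) * Real.sin (γ * t)) := by
  have hi1 : Integrable fun t ↦ f t * (Real.cosh (η * t) * Real.sin (γ * t)) :=
    (hf.mul (by fun_prop)).integrable_of_hasCompactSupport hfs.mul_right
  have hi2 : Integrable fun t ↦ f t * (Real.sinh (η * t) * Real.sin (γ * t)) :=
    (hf.mul (by fun_prop)).integrable_of_hasCompactSupport hfs.mul_right
  have hsplit : ∀ t, f t * (Real.exp (η * t) * Real.sin (γ * t)) =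
      f t * (Real.cosh (η * t) * Real.sin (γ * t)) + f t * (Real.sinh (η * t) * Real.sin (γ * t)) := by
    intro t
    rw [← Real.cosh_add_sinh]
    ring
  simp_rw [hsplit]
  rw [integral_add hi1 hi2, trial_integral_odd_eq_zero (F := fun t ↦ f t *
    (Real.sinh (η * t) * Real.sin (γ * t))) fun t ↦ ?_, add_zero]
  rw [hodd, mul_neg, mul_neg, Real.sinh_neg, Real.sin_neg]
  ring

/-! ## Size of the transform on a window -/

/-- If `o` is continuous with `tsupport o ⊆ [-a, a]`, then for every `ρ`:
`‖ô(ρ)‖ ≤ e^{|Re ρ - 1/2| a} ∫ |o|`. [folklore] -/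
theorem trial_norm_weilMellin_le :
    ∀ (o : ℝ → ℂ) (a : ℝ) (ρ : ℂ), Continuous o → tsupport o ⊆ Set.Icc (-a) a →
      ‖weilMellin o ρ‖ ≤ Real.exp (|ρ.re - 1 / 2| * a) * ∫ t, ‖o t‖ := by
  intro o a ρ hoc hsupp
  have hcs : HasCompactSupport o := isCompact_Icc.of_isClosed_subset (isClosed_tsupport o) hsupp
  have hint : Integrable fun t ↦ Real.exp (|ρ.re - 1 / 2| * a) * ‖o t‖ :=
    ((hoc.norm).integrable_of_hasCompactSupport hcs.norm).const_mul _
  rw [weilMellin, ← integral_const_mul]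
  refine norm_integral_le_of_norm_le hint (Filter.Eventually.of_forall fun t ↦ ?_)
  rw [norm_mul, Complex.norm_exp, mul_comm]
  by_cases ht : t ∈ tsupport o
  · have hta : |t| ≤ a := abs_le.2 ⟨(hsupp ht).1, (hsupp ht).2⟩
    refine mul_le_mul_of_nonneg_right (Real.exp_le_exp.2 ?_) (norm_nonneg _)
    have hre : ((ρ - 1 / 2) * (t : ℂ)).re = (ρ.re - 1 / 2) * t := by simp [Complex.mul_re]
    rw [hre]
    calc (ρ.re - 1 / 2) * t ≤ |(ρ.re - 1 / 2) * t| := le_abs_self _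
      _ = |ρ.re - 1 / 2| * |t| := abs_mul _ _
      _ ≤ |ρ.re - 1 / 2| * a := mul_le_mul_of_nonneg_left hta (abs_nonneg _)
  · rw [image_eq_zero_of_notMem_tsupport ht, norm_zero, mul_zero, mul_zero]

/-! ## The quadruple symmetry of `Re ô(ρ)²` for real odd tests -/

/-- For a real-valued `o`: `Re ô(ρ̄)² = Re ô(ρ)²` (`ô(ρ̄) = conj ô(ρ)`). [folklore] -/
theorem trial_re_sq_weilMellin_conj {o : ℝ → ℂ} (hreal : ∀ t, (o t).im = 0) (s : ℂ) :
    ((weilMellin o (conj s)) ^ 2).re = ((weilMellin o s) ^ 2).re := by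
  rw [← conj_weilMellin_of_real hreal, ← map_pow, Complex.conj_re]

/-- For an odd `o`: `Re ô(1 - ρ)² = Re ô(ρ)²` (`ô(1 - ρ) = -ô(ρ)`). [folklore] -/
theorem trial_re_sq_weilMellin_one_sub {o : ℝ → ℂ} (hodd : ∀ t, o (-t) = -o t) (s : ℂ) :
    ((weilMellin o (1 - s)) ^ 2).re = ((weilMellin o s) ^ 2).re := by
  rw [weilMellin_one_sub_of_odd hodd, neg_sq]

/-- `Re z² ≥ -‖z‖²`. [folklore] -/
theorem trial_neg_norm_sq_le_re_sq (z : ℂ) : -‖z‖ ^ 2 ≤ (z ^ 2).re := by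
  rw [Complex.sq_norm, Complex.normSq_apply, sq, Complex.mul_re]
  nlinarith [sq_nonneg z.re]

/-! ## The threshold integral `∫_{[-a,a]} sinh²(ηt) sin²(γt) dt` -/

/-- The threshold integral depends only on `|η|` and `|γ|`. [folklore] -/
theorem trial_threshold_abs (η γ a : ℝ) :
    ∫ t in Icc (-a) a, Real.sinh (η * t) ^ 2 * Real.sin (γ * t) ^ 2 =
      ∫ t in Icc (-a) a, Real.sinh (|η| * t) ^ 2 * Real.sin (|γ| * t) ^ 2 := by
  congr 1 with t
  rcases abs_choice η with h | h <;> rcases abs_choice γ with h' | h' <;>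
    simp [h, h', neg_mul, Real.sinh_neg, Real.sin_neg]

/-- The threshold integral is non-negative. [folklore] -/
theorem trial_threshold_nonneg (η γ a : ℝ) :
    0 ≤ ∫ t in Icc (-a) a, Real.sinh (η * t) ^ 2 * Real.sin (γ * t) ^ 2 :=
  integral_nonneg fun t ↦ by positivity

/-- The threshold integral is at most `2a e^{2|η|a}` (for `a ≥ 0`). [folklore] -/
theorem trial_threshold_le (η γ : ℝ) {a : ℝ} (ha : 0 ≤ a) :
    ∫ t in Icc (-a) a, Real.sinh (η * t) ^ 2 * Real.sin (γ * t) ^ 2 ≤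
      2 * a * Real.exp (2 * |η| * a) := by
  have hb : ∀ t ∈ Icc (-a) a, ‖Real.sinh (η * t) ^ 2 * Real.sin (γ * t) ^ 2‖ ≤
      Real.exp (2 * |η| * a) := fun t ht ↦ by
    rw [Real.norm_eq_abs, abs_of_nonneg (by positivity)]
    have hta : |t| ≤ a := abs_le.2 ⟨ht.1, ht.2⟩
    calc Real.sinh (η * t) ^ 2 * Real.sin (γ * t) ^ 2 ≤ Real.sinh (η * t) ^ 2 * 1 :=
          mul_le_mul_of_nonneg_left (Real.sin_sq_le_one _) (sq_nonneg _)
      _ ≤ Real.exp (2 * |η| * a) := by rw [mul_one]; exact trial_sinh_sq_le_exp_window hta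
  have h := norm_setIntegral_le_of_norm_le_const (measure_Icc_lt_top (μ := volume)) hb
  rw [Real.volume_real_Icc_of_le (by linarith)] at h
  calc _ ≤ _ := Real.le_norm_self _
    _ ≤ Real.exp (2 * |η| * a) * (a - -a) := h
    _ = 2 * a * Real.exp (2 * |η| * a) := by ring

/-! ## Integral comparisons for the plateau trial function -/

/-- `∫ f² ≤ ∫ f s` for `f = χ s` with `0 ≤ χ ≤ 1` (`f² = χ² s² ≤ χ s² = f s`). [folklore] -/
theorem trial_norm_sq_le_re {χ s : ℝ → ℝ} (hfc : Continuous fun t ↦ χ t * s t)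
    (hfs : HasCompactSupport fun t ↦ χ t * s t) (hs : Continuous s) (hχ0 : ∀ t, 0 ≤ χ t)
    (hχ1 : ∀ t, χ t ≤ 1) :
    ∫ t, (χ t * s t) ^ 2 ≤ ∫ t, χ t * s t * s t := by
  have hfs2 : HasCompactSupport fun t ↦ (χ t * s t) ^ 2 :=
    hfs.comp_left (g := fun x : ℝ ↦ x ^ 2) (zero_pow two_ne_zero)
  refine integral_mono ((hfc.pow 2).integrable_of_hasCompactSupport hfs2)
    ((hfc.mul hs).integrable_of_hasCompactSupport hfs.mul_right) fun t ↦ ?_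
  have h1 : χ t * χ t ≤ χ t := by nlinarith [hχ0 t, hχ1 t]
  show (χ t * s t) ^ 2 ≤ χ t * s t * s t
  nlinarith [sq_nonneg (s t), h1]

/-- `∫_{[-b,b]} s² ≤ ∫ f²` for `f = χ s` with `χ = 1` on `[-b, b]`. [folklore] -/
theorem trial_inner_le_norm_sq {χ s : ℝ → ℝ} (hfc : Continuous fun t ↦ χ t * s t)
    (hfs : HasCompactSupport fun t ↦ χ t * s t) (hs : Continuous s) {b : ℝ}
    (hχin : ∀ t, |t| ≤ b → χ t = 1) :
    ∫ t in Icc (-b) b, s t ^ 2 ≤ ∫ t, (χ t * s t) ^ 2 := by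
  have hfs2 : HasCompactSupport fun t ↦ (χ t * s t) ^ 2 :=
    hfs.comp_left (g := fun x : ℝ ↦ x ^ 2) (zero_pow two_ne_zero)
  rw [← integral_indicator measurableSet_Icc]
  refine integral_mono ?_ ((hfc.pow 2).integrable_of_hasCompactSupport hfs2) fun t ↦ ?_
  · exact (integrable_indicator_iff measurableSet_Icc).2 ((hs.pow 2).integrableOn_Icc)
  · refine Set.indicator_apply_le' (fun ht ↦ ?_) (fun _ ↦ sq_nonneg _)
    rw [hχin t (abs_le.2 ⟨ht.1, ht.2⟩), one_mul]

/-- `∫ f² ≤ ∫_{[-a,a]} s²` for `f = χ s` with `0 ≤ χ ≤ 1` and `χ = 0` off `(-a, a)`. [folklore] -/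
theorem trial_norm_sq_le_window {χ s : ℝ → ℝ} (hfc : Continuous fun t ↦ χ t * s t)
    (hs : Continuous s) (hχ0 : ∀ t, 0 ≤ χ t) (hχ1 : ∀ t, χ t ≤ 1) {a : ℝ}
    (hχout : ∀ t, a ≤ |t| → χ t = 0) :
    ∫ t, (χ t * s t) ^ 2 ≤ ∫ t in Icc (-a) a, s t ^ 2 := by
  have hzero : ∀ t, t ∉ Icc (-a) a → (χ t * s t) ^ 2 = 0 := fun t ht ↦ by
    have hta : a ≤ |t| := by
      simp only [mem_Icc, not_and_or, not_le] at ht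
      rcases ht with h | h
      · exact (show a ≤ -t by linarith).trans (neg_le_abs t)
      · exact h.le.trans (le_abs_self t)
    rw [hχout t hta, zero_mul, zero_pow two_ne_zero]
  rw [← setIntegral_eq_integral_of_forall_compl_eq_zero hzero]
  refine setIntegral_mono_on ?_ ((hs.pow 2).integrableOn_Icc) measurableSet_Icc fun t _ ↦ ?_
  · exact (hfc.pow 2).integrableOn_Icc
  · have h1 : χ t ^ 2 ≤ 1 := by nlinarith [hχ0 t, hχ1 t]
    show (χ t * s t) ^ 2 ≤ s t ^ 2
    nlinarith [sq_nonneg (s t), h1]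

/-! ## The transform of the trial function at the dominant point -/

/-- For the odd trial function `f = χ s` (`s = sinh(η·) cos(γ·)`, `χ` even) at the dominant point
`ρ⋆ = 1/2 + η + iγ`: `Re f̂(ρ⋆) = ∫ f s` and `Im f̂(ρ⋆) = ∫ f c` with `c = cosh(η·) sin(γ·)`. [folklore] -/
theorem trial_re_im_dominant {χ : ℝ → ℝ} {η γ : ℝ}
    (hfc : Continuous fun t ↦ χ t * (Real.sinh (η * t) * Real.cos (γ * t)))
    (hfs : HasCompactSupport fun t ↦ χ t * (Real.sinh (η * t) * Real.cos (γ * t)))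
    (hχev : ∀ t, χ (-t) = χ t) :
    (weilMellin (fun t ↦ ((χ t * (Real.sinh (η * t) * Real.cos (γ * t)) : ℝ) : ℂ)) ⟨1 / 2 + η, γ⟩).re =
        ∫ t, χ t * (Real.sinh (η * t) * Real.cos (γ * t)) * (Real.sinh (η * t) * Real.cos (γ * t)) ∧
      (weilMellin (fun t ↦ ((χ t * (Real.sinh (η * t) * Real.cos (γ * t)) : ℝ) : ℂ)) ⟨1 / 2 + η, γ⟩).im =
        ∫ t, χ t * (Real.sinh (η * t) * Real.cos (γ * t)) * (Real.cosh (η * t) * Real.sin (γ * t)) := by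
  have hodd : ∀ t, χ (-t) * (Real.sinh (η * -t) * Real.cos (γ * -t)) =
      -(χ t * (Real.sinh (η * t) * Real.cos (γ * t))) := fun t ↦ by
    rw [hχev, mul_neg, mul_neg, Real.sinh_neg, Real.cos_neg]
    ring
  have hre : ((⟨1 / 2 + η, γ⟩ : ℂ).re - 1 / 2) = η := by simp
  have him : (⟨1 / 2 + η, γ⟩ : ℂ).im = γ := rfl
  constructor
  · rw [trial_weilMellin_re hfc hfs, hre, him,
      trial_integral_odd_mul_exp_mul_cos (f := fun t ↦ χ t * (Real.sinh (η * t) * Real.cos (γ * t)))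
        hfc hfs hodd]
  · rw [trial_weilMellin_im hfc hfs, hre, him,
      trial_integral_odd_mul_exp_mul_sin (f := fun t ↦ χ t * (Real.sinh (η * t) * Real.cos (γ * t)))
        hfc hfs hodd]

/-- **The cross term is small.** For the trial function `f = χ s` on the window `[-a, a]`
(`χ = 1` on `|t| ≤ a - δ`, `f = 0` off `[-a, a]`) at a phase `cos(2γa) = η/r`, `sin(2γa) = γ/r`:
`|∫ f(t) cosh(ηt) sin(γt) dt| ≤ (1/r + 2δ sinh(2ηa)) / 4`, because
`f cosh sin = χ sinh(2ηt) sin(2γt)/4`, `∫_{-a}^{a} sinh(2ηt) sin(2γt) = ηγ e^{-2ηa}/r³` and `χ - 1`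
lives on the boundary layers of width `δ`. [folklore] -/
theorem trial_cross_le {χ : ℝ → ℝ} {η γ a δ : ℝ} (hη : 0 < η) (hδ : 0 < δ) (hδa : δ ≤ a)
    (hfc : Continuous fun t ↦ χ t * (Real.sinh (η * t) * Real.cos (γ * t)))
    (hχ0 : ∀ t, 0 ≤ χ t) (hχ1 : ∀ t, χ t ≤ 1) (hχin : ∀ t, |t| ≤ a - δ → χ t = 1)
    (hχout : ∀ t, a ≤ |t| → χ t = 0)
    (hcos : Real.cos (2 * γ * a) = η / Real.sqrt (η ^ 2 + γ ^ 2))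
    (hsin : Real.sin (2 * γ * a) = γ / Real.sqrt (η ^ 2 + γ ^ 2)) :
    |∫ t, χ t * (Real.sinh (η * t) * Real.cos (γ * t)) * (Real.cosh (η * t) * Real.sin (γ * t))| ≤
      (1 / Real.sqrt (η ^ 2 + γ ^ 2) + 2 * δ * Real.sinh (2 * η * a)) / 4 := by
  have ha : 0 ≤ a := hδ.le.trans hδa
  set h : ℝ → ℝ := fun t ↦ Real.sinh (2 * η * t) * Real.sin (2 * γ * t) with hh
  set F : ℝ → ℝ := fun t ↦ χ t * (Real.sinh (η * t) * Real.cos (γ * t)) *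
    (Real.cosh (η * t) * Real.sin (γ * t)) with hF
  have hpt : ∀ t, F t = χ t * h t / 4 := fun t ↦ by
    simp only [hF, hh]
    rw [mul_assoc, trial_sinh_cos_cosh_sin]
    ring
  have hFc : Continuous F := hfc.mul (by fun_prop)
  have hhc : Continuous h := by simp only [hh]; fun_prop
  have hFh : Continuous fun t ↦ F t - h t / 4 := hFc.sub (hhc.div_const 4)
  have hh4 : Continuous fun t ↦ h t / 4 := hhc.div_const 4
  -- off the window `F = 0`
  have hout : ∀ t, t ∉ Icc (-a) a → a ≤ |t| := fun t ht ↦ by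
    simp only [mem_Icc, not_and_or, not_le] at ht
    rcases ht with h1 | h1
    · exact (show a ≤ -t by linarith).trans (neg_le_abs t)
    · exact h1.le.trans (le_abs_self t)
  have hF0 : ∀ t, t ∉ Icc (-a) a → F t = 0 := fun t ht ↦ by
    rw [hpt, hχout t (hout t ht)]
    ring
  have hI : ∫ t, F t = ∫ t in (-a)..a, F t := by
    rw [← setIntegral_eq_integral_of_forall_compl_eq_zero hF0, trial_integral_Icc_eq ha]
  -- split `F = h/4 + (F - h/4)` on the window
  have hsplit : ∫ t in (-a)..a, F t =
      (∫ t in (-a)..a, h t / 4) + ∫ t in (-a)..a, (F t - h t / 4) := by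
    rw [← intervalIntegral.integral_add (hh4.intervalIntegrable _ _) (hFh.intervalIntegrable _ _)]
    congr 1 with t
    ring
  -- the full cross integral is tiny at the phase
  have h1 : |∫ t in (-a)..a, h t / 4| ≤ 1 / Real.sqrt (η ^ 2 + γ ^ 2) / 4 := by
    rw [intervalIntegral.integral_div, abs_div, abs_of_pos (by norm_num : (0 : ℝ) < 4)]
    exact div_le_div_of_nonneg_right (trial_phase_abs_cross_le hη ha hcos hsin) (by norm_num)
  -- the layer term
  have h2 : |∫ t in (-a)..a, (F t - h t / 4)| ≤ 2 * δ * Real.sinh (2 * η * a) / 4 := by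
    have hin : ∫ t in (-(a - δ))..(a - δ), (F t - h t / 4) = 0 := by
      rw [intervalIntegral.integral_congr (g := fun _ ↦ (0 : ℝ)) fun t ht ↦ ?_,
        intervalIntegral.integral_zero]
      have hta : |t| ≤ a - δ := by
        rw [Set.uIcc_of_le (by linarith)] at ht
        exact abs_le.2 ⟨ht.1, ht.2⟩
      show F t - h t / 4 = 0
      rw [hpt, hχin t hta]
      ring
    have hB : ∀ t, |t| ≤ a → |F t - h t / 4| ≤ Real.sinh (2 * η * a) / 4 := fun t hta ↦ by
      rw [hpt, show χ t * h t / 4 - h t / 4 = (χ t - 1) * h t / 4 by ring, abs_div, abs_mul,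
        abs_of_pos (by norm_num : (0 : ℝ) < 4)]
      refine div_le_div_of_nonneg_right ?_ (by norm_num)
      have hχabs : |χ t - 1| ≤ 1 := abs_le.2 ⟨by linarith [hχ0 t], by linarith [hχ1 t]⟩
      have hhabs : |h t| ≤ Real.sinh (2 * η * a) := by
        simp only [hh, abs_mul]
        calc |Real.sinh (2 * η * t)| * |Real.sin (2 * γ * t)| ≤ Real.sinh (2 * η * a) * 1 :=
              mul_le_mul (trial_abs_sinh_le_window (by positivity) hta) (Real.abs_sin_le_one _)
                (abs_nonneg _) (Real.sinh_nonneg_iff.2 (by positivity))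
          _ = Real.sinh (2 * η * a) := mul_one _
      calc |χ t - 1| * |h t| ≤ 1 * Real.sinh (2 * η * a) :=
            mul_le_mul hχabs hhabs (abs_nonneg _) zero_le_one
        _ = Real.sinh (2 * η * a) := one_mul _
    have hl := trial_layer_le hFh (b := a - δ) (by linarith) (by linarith) hB
    rw [hin, sub_zero] at hl
    calc _ ≤ 2 * (a - (a - δ)) * (Real.sinh (2 * η * a) / 4) := hl
      _ = 2 * δ * Real.sinh (2 * η * a) / 4 := by ring
  rw [hI, hsplit]
  calc _ ≤ |∫ t in (-a)..a, h t / 4| + |∫ t in (-a)..a, (F t - h t / 4)| := abs_add_le _ _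
    _ ≤ 1 / Real.sqrt (η ^ 2 + γ ^ 2) / 4 + 2 * δ * Real.sinh (2 * η * a) / 4 := add_le_add h1 h2
    _ = (1 / Real.sqrt (η ^ 2 + γ ^ 2) + 2 * δ * Real.sinh (2 * η * a)) / 4 := by ring

end Summit.RiemannHypothesis.RiemannHypothesis.Theorems.WeilParityOffLineParityDetection

end
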